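import Literature.Computability.AlgebraicComplexity.BI17FundamentalInvariantForms
import Literature.Computability.AlgebraicComplexity.MS2001FormEPolystableComplex
import Mathlib.Analysis.Calculus.LocalExtr.Basic
import Mathlib.Analysis.SpecialFunctions.ExpDeriv
import Mathlib.LinearAlgebra.Matrix.Transvection
import Mathlib.Topology.Algebra.Module.FiniteDimension
import HarnessLib

/-!
# The polystability criterion for forms (BI 2017 Prop. 2.8), corrected form, proved

P. Bürgisser, C. Ikenmeyer, *Fundamental invariants of orbit closures*, J. Algebra **477** (2017)
390–434 = arXiv:1511.02927 [BurgisserIkenmeyer2017], §2.2, Prop. 2.8 (TeX `main.tex` L565,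
held text `paper:arxiv-1511.02927` p0006:L140): "Let the form `w ∈ Sym^D ℂ^m` satisfy the
following two properties: 1. There is a reductive subgroup `R` of `SL_m ∩ stab(w)` such that the
centralizer of `R` in `SL_m` is contained in the group of diagonal matrices. 2. The convex cone
generated by `supp(w)` contains `(1,…,1)`. Then `w` is polystable."

As printed (and as typed in the tree: `BI2017_prop_2_8_diag`, diagonal `R`, rational `c_α ≥ 0`
with `∑_{α ∈ supp w} c_α α = (1,…,1)`) the statement is FALSE — see the sibling file
`BI17FormPolystabilityCounterexample.lean` (`not_BI2017_prop_2_8_diag`, cell `val-lit` erratum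
A31): the printed proof's last step "this implies `μ_i = 0` for all `i`" only controls `⟨α, μ⟩` for
the `α` with `c_α > 0`. This file proves the **corrected statement** in which ALL `c_α`,
`α ∈ supp(w)`, are positive (`(1,…,1)` in the relative interior of the cone — the form of the
criterion in H. Derksen, V. Makam, Lemma 3.1 of their 2022 cubic-forms paper):
`isPolystable_of_diagonalStabilizer_of_posCone` (any finite index type) and, in the shape of the
tree's fact with the single extra conjunct `0 < c α` on `supp(f)`, `BI2017_prop_2_8_diag_corrected`.
Every application in the paper (Cor. 2.9: `X₁⋯X_m`, `∑ X_i^D`, `det_n`, `per_n`) has positive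
`c`, so is an instance of the corrected statement (tree theorems
`BI2017_cor_2_9_chow_powerSum_holds`, `BurgisserIkenmeyer2017_polystable_det_per_holds`).

## Proof (Kempf–Ness route; forms twin of `BI17TensorPolystabilityCriterion.lean`)

The printed proof needs the Hilbert–Mumford criterion refined by Luna and Kempf, absent from
Mathlib. Instead we use the tree's Kempf–Ness pipeline for forms,
`isPolystable_tensorToPoly_of_momentMatrix_eq_smul_one` (`PolystabilityProofs.lean`: the
polynomial shadow of a SYMMETRIC tensor with SCALAR moment matrix has a Zariski-closed
`SL`-orbit), applied to a torus rescaling `S' = diag(e^{x/2}) • S₀` of the symmetric tensor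
`S₀ = symTensor D f` of the form (`MS2001FormEPolystableComplex.lean`, `tensorToPoly_symTensor`):
1. **Symmetry makes the support rigid** (`support_rigid_of_diagonalStabilizer`). For letters
   `a ≠ b` the transvection `1 + E_{ab}` is not diagonal, so by hypothesis 1 it fails to commute with
   some `diag(d) ∈ R`, i.e. `d_a ≠ d_b`; `diag(d)` fixes `f`, so `d^α = 1` on `supp(f)`
   (`coeff_linSubst_diagonal`); hence no two exponents `α, α − e_a + e_b` both lie in `supp(f)`, i.e.
   no two words in the support of `S₀` differ in exactly one slot, and the off-diagonal entries of
   the moment matrix of every tensor supported inside `supp(S₀)` vanish.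
2. **Torus scaling equalizes the diagonal moment entries** (private `exists_isMinOn_sum_mul_exp`,
   `sum_mul_eq_zero_of_forall_le_sum_mul_exp`, the same analysis as in the tensor twin). Minimize
   `F(x) = ∑_{j ∈ supp S₀} |S₀ j|² e^{∑_k x_{j_k}}` over traceless `x`. Hypothesis 2 with ALL
   `c_α > 0` gives positive word weights `a_j = c_{α_j}/(N_{α_j} ∑ c)` with `∑_j a_j u_j = 0` on the
   subspace (`∑_α c_α α = 𝟙` and `∑ x = 0`; the fibres of the content map are counted in
   `sum_fiber_content`), so `F` is coercive there and a minimiser exists; the first-order conditions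
   in the directions `e_a − e_b` say `∑_j (content_j a) |S' j|²` is independent of `a` — these are
   the diagonal entries of `momentMatrix S'`.
3. **Assembly.** `S'` is symmetric with scalar moment matrix, so `tensorToPoly S' = diag(e^{x/2})·f`
   is polystable, and `SL·(diag(e^{x/2})·f) = SL·f`.

Consumable forms: `isPolystable_of_rigid_of_posCone` (rigid support + positive cone),
`isPolystable_of_separating_diagonalStabilizers` (separating diagonal stabilizers + positive cone;
no subgroup bookkeeping), and the application `isPolystable_univ_prod_X_pow` /
`isPolystable_prod_X_pow` (`(∏_i X_i)^a`, any finite set of variables / `Fin m`).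

Cell `val-lit`, row BI2017-A (erratum A31, corrected statement). Honest framing: bookkeeping of
BI 2017 §2.2; VP ≠ VNP is NOT proved and nothing here bears on it.

## References

* [BurgisserIkenmeyer2017] P. Bürgisser, C. Ikenmeyer, *Fundamental invariants of orbit closures*,
  J. Algebra 477 (2017) 390–434; arXiv:1511.02927, §2.2, Prop. 2.8, Cor. 2.9.
* H. Derksen, V. Makam, *An exponential lower bound for the degrees of invariants of cubic forms and
  tensor actions* (2022), Lemma 3.1 (relative-interior form of the criterion).
* G. Kempf, L. Ness, *The length of vectors in representation spaces*, LNM 732 (1979), Thm. 0.1–0.2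
  (via the tree's `isPolystable_tensorToPoly_of_momentMatrix_eq_smul_one`).
-/

noncomputable section

open Filter MvPolynomial
open scoped Topology ComplexConjugate

namespace Literature.Computability.AlgebraicComplexity

/-! ### Analysis: coercive minimisation of `∑ q_p e^{u_p}` on a subspace, first-order condition -/

section Analysis

variable {T : Type*} [Fintype T]

/-- **First-order condition.** If `s ↦ ∑_p c_p e^{s d_p}` is minimal at `s = 0`, then
`∑_p c_p d_p = 0`. [folklore] -/
private theorem sum_mul_eq_zero_of_forall_le_sum_mul_exp (c d : T → ℝ)
    (h : ∀ s : ℝ, ∑ p, c p ≤ ∑ p, c p * Real.exp (s * d p)) : ∑ p, c p * d p = 0 := by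
  have hderiv : HasDerivAt (fun s : ℝ => ∑ p, c p * Real.exp (s * d p)) (∑ p, c p * d p) 0 := by
    have h1 : HasDerivAt (fun s : ℝ => ∑ p, c p * Real.exp (s * d p))
        (∑ p, c p * (Real.exp (0 * d p) * (1 * d p))) 0 := by
      refine HasDerivAt.fun_sum fun p _ => ?_
      exact (((hasDerivAt_id (0 : ℝ)).mul_const (d p)).exp).const_mul (c p)
    simpa using h1
  have hmin : IsLocalMin (fun s : ℝ => ∑ p, c p * Real.exp (s * d p)) 0 := by
    refine Filter.Eventually.of_forall fun s => ?_
    simpa using h s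
  exact hmin.hasDerivAt_eq_zero hderiv

/-- **Coercive minimisation.** Let `q, a > 0` on a nonempty finite `T`, `∑ a = 1`, and let `U` be a
linear subspace of `ℝ^T` on which `∑_p a_p u_p = 0`. Then `u ↦ ∑_p q_p e^{u_p}` attains its
minimum on `U` (it is bounded below by `q_min e^{a_min ‖u‖_∞}` there). [folklore] -/
private theorem exists_isMinOn_sum_mul_exp [Nonempty T] (q a : T → ℝ) (hq : ∀ p, 0 < q p)
    (ha : ∀ p, 0 < a p) (hsum : ∑ p, a p = 1) (U : Submodule ℝ (T → ℝ))
    (hU : ∀ u ∈ U, ∑ p, a p * u p = 0) :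
    ∃ u₀ ∈ U, ∀ u ∈ U, ∑ p, q p * Real.exp (u₀ p) ≤ ∑ p, q p * Real.exp (u p) := by
  classical
  set F : (T → ℝ) → ℝ := fun u => ∑ p, q p * Real.exp (u p) with hF
  have hne : (Finset.univ : Finset T).Nonempty := Finset.univ_nonempty
  set amin := Finset.univ.inf' hne a with hamin
  set qmin := Finset.univ.inf' hne q with hqmin
  have hamin_le : ∀ p, amin ≤ a p := fun p => Finset.inf'_le _ (Finset.mem_univ p)
  have hqmin_le : ∀ p, qmin ≤ q p := fun p => Finset.inf'_le _ (Finset.mem_univ p)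
  have hamin_pos : 0 < amin := by
    obtain ⟨p, _, hp⟩ := Finset.exists_mem_eq_inf' hne a
    rw [hamin, hp]; exact ha p
  have hqmin_pos : 0 < qmin := by
    obtain ⟨p, _, hp⟩ := Finset.exists_mem_eq_inf' hne q
    rw [hqmin, hp]; exact hq p
  have hamin_le_one : amin ≤ 1 := by
    obtain ⟨p₀⟩ := ‹Nonempty T›
    calc amin ≤ a p₀ := hamin_le p₀
      _ ≤ ∑ p, a p := Finset.single_le_sum (f := a) (fun p _ => (ha p).le) (Finset.mem_univ p₀)
      _ = 1 := hsum
  -- key bound: on `U`, the largest coordinate controls the sup norm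
  have key : ∀ u ∈ U, amin * ‖u‖ ≤ Finset.univ.sup' hne u := by
    intro u hu
    set M := Finset.univ.sup' hne u with hM
    have hle : ∀ p, u p ≤ M := fun p => Finset.le_sup' u (Finset.mem_univ p)
    have hM0 : 0 ≤ M := by
      by_contra hneg
      push Not at hneg
      have hlt : ∑ p, a p * u p < 0 := by
        calc ∑ p, a p * u p < ∑ _p : T, (0 : ℝ) :=
              Finset.sum_lt_sum_of_nonempty hne fun p _ =>
                mul_neg_of_pos_of_neg (ha p) (lt_of_le_of_lt (hle p) hneg)
          _ = 0 := by simp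
      linarith [hU u hu]
    have hbound : ∀ p, ‖u p‖ ≤ M / amin := by
      intro p
      rw [Real.norm_eq_abs, abs_le]
      constructor
      · have h1 : a p * u p + ∑ p' ∈ Finset.univ.erase p, a p' * u p' = 0 := by
          rw [Finset.add_sum_erase Finset.univ (fun p' => a p' * u p') (Finset.mem_univ p)]
          exact hU u hu
        have h2 : ∑ p' ∈ Finset.univ.erase p, a p' * u p' ≤
            ∑ p' ∈ Finset.univ.erase p, a p' * M :=
          Finset.sum_le_sum fun p' _ => mul_le_mul_of_nonneg_left (hle p') (ha p').le
        have h3 : ∑ p' ∈ Finset.univ.erase p, a p' * M ≤ M := by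
          rw [← Finset.sum_mul]
          have hs : ∑ p' ∈ Finset.univ.erase p, a p' ≤ 1 := by
            calc ∑ p' ∈ Finset.univ.erase p, a p' ≤ ∑ p', a p' :=
                  Finset.sum_le_sum_of_subset_of_nonneg (Finset.erase_subset _ _)
                    fun i _ _ => (ha i).le
              _ = 1 := hsum
          calc (∑ p' ∈ Finset.univ.erase p, a p') * M ≤ 1 * M :=
                mul_le_mul_of_nonneg_right hs hM0
            _ = M := one_mul M
        have h4 : -M ≤ a p * u p := by linarith
        have h5 : -M / a p ≤ u p := by
          rw [div_le_iff₀ (ha p)]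
          linarith
        have h6 : M / a p ≤ M / amin := div_le_div_of_nonneg_left hM0 hamin_pos (hamin_le p)
        rw [neg_div] at h5
        linarith
      · calc u p ≤ M := hle p
          _ ≤ M / amin := by
            rw [le_div_iff₀ hamin_pos]
            calc M * amin ≤ M * 1 := mul_le_mul_of_nonneg_left hamin_le_one hM0
              _ = M := mul_one M
    have hnorm : ‖u‖ ≤ M / amin :=
      (pi_norm_le_iff_of_nonneg (div_nonneg hM0 hamin_pos.le)).mpr hbound
    calc amin * ‖u‖ ≤ amin * (M / amin) := mul_le_mul_of_nonneg_left hnorm hamin_pos.le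
      _ = M := mul_div_cancel₀ M hamin_pos.ne'
  -- lower bound on `U`
  have hlow : ∀ u ∈ U, qmin * Real.exp (amin * ‖u‖) ≤ F u := by
    intro u hu
    obtain ⟨p, _, hp⟩ := Finset.exists_mem_eq_sup' hne u
    have h1 : qmin * Real.exp (amin * ‖u‖) ≤ q p * Real.exp (u p) := by
      apply mul_le_mul (hqmin_le p) _ (Real.exp_pos _).le (hq p).le
      exact Real.exp_le_exp.mpr (hp ▸ key u hu)
    calc qmin * Real.exp (amin * ‖u‖) ≤ q p * Real.exp (u p) := h1
      _ ≤ F u := by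
        rw [hF]
        exact Finset.single_le_sum (f := fun p => q p * Real.exp (u p))
          (fun p _ => (mul_pos (hq p) (Real.exp_pos _)).le) (Finset.mem_univ p)
  have hcont : Continuous F := by
    rw [hF]
    exact continuous_finsetSum _ fun p _ =>
      continuous_const.mul (Real.continuous_exp.comp (continuous_apply p))
  have hclosed : IsClosed (U : Set (T → ℝ)) := U.closed_of_finiteDimensional
  have hc : ∀ᶠ u in cocompact (T → ℝ) ⊓ 𝓟 (U : Set (T → ℝ)), F 0 ≤ F u := by
    rw [Filter.eventually_inf_principal]
    have ht : Tendsto (fun s : ℝ => qmin * Real.exp (amin * s)) atTop atTop :=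
      (Real.tendsto_exp_atTop.comp (tendsto_id.const_mul_atTop hamin_pos)).const_mul_atTop
        hqmin_pos
    obtain ⟨r, hr⟩ := Filter.eventually_atTop.mp (ht.eventually (eventually_ge_atTop (F 0)))
    have hev : ∀ᶠ u in cocompact (T → ℝ), r ≤ ‖u‖ :=
      tendsto_norm_cocompact_atTop.eventually (eventually_ge_atTop r)
    refine hev.mono fun u hu huU => ?_
    calc F 0 ≤ qmin * Real.exp (amin * ‖u‖) := by
          have h1 := hr ‖u‖ hu
          exact h1.trans (le_of_eq rfl)
      _ ≤ F u := hlow u huU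
  obtain ⟨u₀, hu₀, hmin⟩ := hcont.continuousOn.exists_isMinOn' hclosed U.zero_mem hc
  exact ⟨u₀, hu₀, fun u hu => (isMinOn_iff.mp hmin) u hu⟩

end Analysis
/-! ### Symmetry: diagonal stabilizers make the support rigid -/

section Separation

variable {σ : Type*} [Fintype σ] [DecidableEq σ]

/-- A transvection `1 + E_{ab}` commutes with a diagonal matrix whose entries at `a` and `b`
agree. [folklore] -/
private theorem transvection_comm_diagonal' {a b : σ} (d : σ → ℂ) (h : d a = d b) :
    Matrix.transvection a b (1 : ℂ) * Matrix.diagonal d =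
      Matrix.diagonal d * Matrix.transvection a b (1 : ℂ) := by
  ext p q
  rw [Matrix.mul_diagonal, Matrix.diagonal_mul]
  by_cases hpq : p = q
  · subst hpq; ring
  · have hT : Matrix.transvection a b (1 : ℂ) p q = if a = p ∧ b = q then 1 else 0 := by
      simp [Matrix.transvection, Matrix.one_apply_ne hpq, Matrix.single]
    rw [hT]
    by_cases h' : a = p ∧ b = q
    · obtain ⟨rfl, rfl⟩ := h'
      rw [if_pos ⟨rfl, rfl⟩, h]; ring
    · rw [if_neg h']; ring

omit [Fintype σ] in
/-- A transvection `1 + E_{ab}`, `a ≠ b`, is not a diagonal matrix. [folklore] -/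
private theorem not_isDiag_transvection' {a b : σ} (hab : a ≠ b) :
    ¬ (Matrix.transvection a b (1 : ℂ)).IsDiag := by
  intro hd
  have := hd hab
  simp [Matrix.transvection, Matrix.one_apply_ne hab, Matrix.single] at this

/-- Coefficients of a diagonally substituted polynomial: `coeff_α (diag(d) · f) = d^α coeff_α f`.
[folklore] -/
private theorem coeff_linSubst_diagonal_fintype (d : σ → ℂ) (f : MvPolynomial σ ℂ)
    (α : σ →₀ ℕ) :
    coeff α (linSubst σ ℂ (Matrix.diagonal d) f) = (∏ i, d i ^ α i) * coeff α f := by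
  conv_lhs => rw [f.as_sum]
  rw [map_sum, coeff_sum]
  simp_rw [linSubst_diagonal_monomial, coeff_smul, coeff_monomial, smul_eq_mul]
  rw [Finset.sum_eq_single α]
  · rw [if_pos rfl, Finsupp.prod_fintype _ _ (fun i => pow_zero _)]
  · intro β _ hβ; rw [if_neg hβ, mul_zero]
  · intro hα; rw [MvPolynomial.notMem_support_iff.mp hα, if_pos rfl, mul_zero]

omit [DecidableEq σ] in
/-- `d^(β + e_a) = d^β · d_a`. [folklore] -/
private theorem prod_pow_add_single (d : σ → ℂ) (β : σ →₀ ℕ) (a : σ) :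
    (∏ i, d i ^ (β + Finsupp.single a 1 : σ →₀ ℕ) i) = (∏ i, d i ^ β i) * d a := by
  simp_rw [Finsupp.add_apply, pow_add, Finset.prod_mul_distrib]
  congr 1
  rw [Finset.prod_eq_single a]
  · rw [Finsupp.single_eq_same, pow_one]
  · intro i _ hi; rw [Finsupp.single_eq_of_ne hi, pow_zero]
  · intro h; exact absurd (Finset.mem_univ a) h

omit [Fintype σ] [DecidableEq σ] in
/-- Changing one slot of a word: `content (update j k b) + e_{j k} = content j + e_b`. [folklore] -/
private theorem tcontent_update_add' {D : ℕ} (j : Fin D → σ) (k : Fin D) (b : σ) :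
    tcontent (Function.update j k b) + Finsupp.single (j k) 1 =
      tcontent j + Finsupp.single b 1 := by
  classical
  unfold tcontent
  rw [← Finset.add_sum_erase _ _ (Finset.mem_univ k),
    ← Finset.add_sum_erase _ (fun k => Finsupp.single (j k) 1) (Finset.mem_univ k),
    Function.update_self]
  have h : ∑ x ∈ Finset.univ.erase k, Finsupp.single (Function.update j k b x) 1 =
      ∑ x ∈ Finset.univ.erase k, Finsupp.single (j x) 1 := by
    refine Finset.sum_congr rfl fun x hx => ?_
    rw [Function.update_of_ne (Finset.ne_of_mem_erase hx)]
  rw [h]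
  abel

/-- For `a ≠ b`, hypothesis 1 of Prop. 2.8 produces a diagonal stabilizer of `f` separating `a`
from `b`. [cite: BurgisserIkenmeyer2017, Prop. 2.8 (proof) / Cor. 2.9 (proof)] -/
private theorem exists_diagonal_stab_sep (f : MvPolynomial σ ℂ)
    (R : Subgroup (Matrix.SpecialLinearGroup σ ℂ))
    (hR : ∀ r ∈ R, (r : Matrix σ σ ℂ).IsDiag ∧ linSubst σ ℂ (r : Matrix σ σ ℂ) f = f)
    (hcent : ∀ g : Matrix.SpecialLinearGroup σ ℂ, (∀ r ∈ R, g * r = r * g) →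
      (g : Matrix σ σ ℂ).IsDiag)
    {a b : σ} (hab : a ≠ b) :
    ∃ d : σ → ℂ, linSubst σ ℂ (Matrix.diagonal d) f = f ∧ d a ≠ d b := by
  classical
  set Tm : Matrix.SpecialLinearGroup σ ℂ :=
    ⟨Matrix.transvection a b 1, Matrix.det_transvection_of_ne _ _ hab 1⟩ with hTm
  obtain ⟨r, hrR, hne⟩ : ∃ r ∈ R, Tm * r ≠ r * Tm := by
    by_contra hall
    push Not at hall
    exact not_isDiag_transvection' hab (hcent _ hall)
  obtain ⟨hdiag, hstab⟩ := hR r hrR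
  have hr := (Matrix.IsDiag.diagonal_diag hdiag).symm
  refine ⟨Matrix.diag (r : Matrix σ σ ℂ), by rw [← hr]; exact hstab, fun heq => hne ?_⟩
  apply Subtype.ext
  change (Tm : Matrix σ σ ℂ) * (r : Matrix σ σ ℂ) = (r : Matrix σ σ ℂ) * (Tm : Matrix σ σ ℂ)
  rw [hr, hTm]
  exact transvection_comm_diagonal' _ heq

/-- **Rigidity of the support from separating diagonal stabilizers**: if for all letters `a ≠ b`
some diagonal substitution fixing `f` has `d_a ≠ d_b`, then no two exponents of `supp(f)` differ by
moving one unit of degree between two variables; in words: if `content(j)` and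
`content(update j k b)` both occur in `f` then `b = j k` (BI 2017 Prop. 2.8, proof: `d^α = 1` on
`supp(f)`). [cite: BurgisserIkenmeyer2017, Prop. 2.8 (proof)] -/
theorem support_rigid_of_separating (f : MvPolynomial σ ℂ)
    (hsep : ∀ a b : σ, a ≠ b → ∃ d : σ → ℂ, linSubst σ ℂ (Matrix.diagonal d) f = f ∧ d a ≠ d b)
    {D : ℕ} (j : Fin D → σ) (k : Fin D) (b : σ) (h1 : coeff (tcontent j) f ≠ 0)
    (h2 : coeff (tcontent (Function.update j k b)) f ≠ 0) : b = j k := by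
  classical
  by_contra hb
  obtain ⟨d, hdf, hdab⟩ := hsep (j k) b (Ne.symm hb)
  have hone : ∀ α : σ →₀ ℕ, coeff α f ≠ 0 → (∏ i, d i ^ α i) = 1 := by
    intro α hα
    have h := congrArg (coeff α) hdf
    rw [coeff_linSubst_diagonal_fintype] at h
    have h' : ((∏ i, d i ^ α i) - 1) * coeff α f = 0 := by rw [sub_mul, one_mul, h, sub_self]
    rcases mul_eq_zero.mp h' with h'' | h''
    · exact sub_eq_zero.mp h''
    · exact absurd h'' hα
  have key : (∏ i, d i ^ (tcontent (Function.update j k b) + Finsupp.single (j k) 1 : σ →₀ ℕ) i) =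
      (∏ i, d i ^ (tcontent j + Finsupp.single b 1 : σ →₀ ℕ) i) := by rw [tcontent_update_add']
  rw [prod_pow_add_single, prod_pow_add_single, hone _ h1, hone _ h2, one_mul, one_mul] at key
  exact hdab key

/-- **Step 1 (rigidity of the support).** Under hypothesis 1 of Prop. 2.8 (diagonal
`R ≤ SL ∩ stab(f)` whose centralizer in `SL` is diagonal), no two exponents of `supp(f)` differ by
moving one unit of degree between two variables; in words: if `content(j)` and
`content(update j k b)` both occur in `f` then `b = j k`. [cite: BurgisserIkenmeyer2017, Prop. 2.8 (proof)] -/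
theorem support_rigid_of_diagonalStabilizer (f : MvPolynomial σ ℂ)
    (R : Subgroup (Matrix.SpecialLinearGroup σ ℂ))
    (hR : ∀ r ∈ R, (r : Matrix σ σ ℂ).IsDiag ∧ linSubst σ ℂ (r : Matrix σ σ ℂ) f = f)
    (hcent : ∀ g : Matrix.SpecialLinearGroup σ ℂ, (∀ r ∈ R, g * r = r * g) →
      (g : Matrix σ σ ℂ).IsDiag)
    {D : ℕ} (j : Fin D → σ) (k : Fin D) (b : σ) (h1 : coeff (tcontent j) f ≠ 0)
    (h2 : coeff (tcontent (Function.update j k b)) f ≠ 0) : b = j k :=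
  support_rigid_of_separating f (fun _ _ hab => exists_diagonal_stab_sep f R hR hcent hab)
    j k b h1 h2

end Separation

/-! ### Bookkeeping: contents, fibres, the traceless subspace on words -/

section Sums

variable {σ : Type*} [Fintype σ] [DecidableEq σ] {D : ℕ}

/-- `∑_k x_{j k} = ∑_i content(j)_i x_i`. [folklore] -/
private theorem sum_comp_eq_sum_tcontent_mul (j : Fin D → σ) (x : σ → ℝ) :
    ∑ k, x (j k) = ∑ i, (tcontent j i : ℝ) * x i := by
  have h1 : ∀ k, x (j k) = ∑ i, (if j k = i then (1 : ℝ) else 0) * x i := by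
    intro k
    simp only [ite_mul, one_mul, zero_mul, Finset.sum_ite_eq, Finset.mem_univ, if_true]
  simp_rw [h1]
  rw [Finset.sum_comm]
  refine Finset.sum_congr rfl fun i _ => ?_
  rw [← Finset.sum_mul, tcontent_apply, Finset.natCast_card_filter]

omit [Fintype σ] in
/-- The number of `a`'s in a word, as a real number. [folklore] -/
private theorem sum_ite_eq_tcontent (j : Fin D → σ) (a : σ) :
    ∑ k, (if j k = a then (1 : ℝ) else 0) = (tcontent j a : ℝ) := by
  rw [tcontent_apply, Finset.natCast_card_filter]

/-- **Summing a function of the content over words**: with `N_α` the number of words of content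
`α`, `∑_j [content j ∈ A] φ(content j)/N_{content j} = ∑_{α ∈ A} φ α`, provided every `α ∈ A`
is a content. [folklore] -/
private theorem sum_fiber_content (A : Finset (σ →₀ ℕ))
    (hA : ∀ α ∈ A, ∃ j : Fin D → σ, tcontent j = α) (φ : (σ →₀ ℕ) → ℝ) :
    ∑ j : Fin D → σ, (if tcontent j ∈ A then
      φ (tcontent j) / ((Finset.univ.filter fun j' : Fin D → σ => tcontent j' = tcontent j).card : ℝ)
      else 0) = ∑ α ∈ A, φ α := by
  classical
  have h := Finset.sum_comp (s := (Finset.univ : Finset (Fin D → σ)))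
    (fun α : σ →₀ ℕ => if α ∈ A then
      φ α / ((Finset.univ.filter fun j' : Fin D → σ => tcontent j' = α).card : ℝ) else 0)
    (tcontent : (Fin D → σ) → σ →₀ ℕ)
  rw [h]
  have hN : ∀ α ∈ Finset.univ.image (tcontent : (Fin D → σ) → σ →₀ ℕ),
      ((Finset.univ.filter fun j' : Fin D → σ => tcontent j' = α).card : ℝ) ≠ 0 := by
    intro α hα
    obtain ⟨j, _, rfl⟩ := Finset.mem_image.mp hα
    have : 0 < (Finset.univ.filter fun j' : Fin D → σ => tcontent j' = tcontent j).card :=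
      Finset.card_pos.mpr ⟨j, by simp⟩
    exact_mod_cast this.ne'
  have hsub : A ⊆ Finset.univ.image (tcontent : (Fin D → σ) → σ →₀ ℕ) := by
    intro α hα
    obtain ⟨j, hj⟩ := hA α hα
    exact Finset.mem_image.mpr ⟨j, Finset.mem_univ _, hj⟩
  calc ∑ α ∈ Finset.univ.image (tcontent : (Fin D → σ) → σ →₀ ℕ),
        (Finset.univ.filter fun j' : Fin D → σ => tcontent j' = α).card •
          (if α ∈ A then
            φ α / ((Finset.univ.filter fun j' : Fin D → σ => tcontent j' = α).card : ℝ) else 0)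
      = ∑ α ∈ Finset.univ.image (tcontent : (Fin D → σ) → σ →₀ ℕ), (if α ∈ A then φ α else 0) := by
        refine Finset.sum_congr rfl fun α hα => ?_
        rw [nsmul_eq_mul]
        split_ifs with hαA
        · rw [mul_comm]; exact div_mul_cancel₀ _ (hN α hα)
        · rw [mul_zero]
    _ = ∑ α ∈ (Finset.univ.image (tcontent : (Fin D → σ) → σ →₀ ℕ)).filter (· ∈ A), φ α := by
        rw [Finset.sum_filter]
    _ = ∑ α ∈ A, φ α := by
        congr 1
        ext α
        simp only [Finset.mem_filter]
        exact ⟨fun h => h.2, fun h => ⟨hsub h, h⟩⟩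

omit [DecidableEq σ] in
/-- The subspace of `T → ℝ` of word sums `p ↦ ∑_k x_{w(p)_k}` with `∑ x = 0` (the Lie algebra of
the diagonal torus of `SL`, restricted to the support words). [folklore] -/
private theorem exists_tracelessSubmodule_words (T : Type*) (w : T → Fin D → σ) :
    ∃ U : Submodule ℝ (T → ℝ), ∀ u, u ∈ U ↔ ∃ x : σ → ℝ, ∑ i, x i = 0 ∧
      u = fun p => ∑ k, x (w p k) := by
  set S : Set (T → ℝ) := {u | ∃ x : σ → ℝ, ∑ i, x i = 0 ∧ u = fun p => ∑ k, x (w p k)} with hS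
  refine ⟨{ carrier := S, add_mem' := ?_, zero_mem' := ?_, smul_mem' := ?_ }, fun u => Iff.rfl⟩
  · rintro u v ⟨x, hx, rfl⟩ ⟨x', hx', rfl⟩
    refine ⟨x + x', ?_, ?_⟩
    · simp [Finset.sum_add_distrib, hx, hx']
    · funext p; simp [Finset.sum_add_distrib]
  · exact ⟨0, by simp, by funext p; simp⟩
  · rintro c u ⟨x, hx, rfl⟩
    refine ⟨c • x, ?_, ?_⟩
    · simp [← Finset.mul_sum, hx]
    · funext p; simp [Finset.mul_sum]

end Sums

/-! ### Orbit transport and the moment matrix of rigid tensors -/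

section Orbit

variable {σ : Type*} [Fintype σ] [DecidableEq σ]

/-- The `SL`-orbit is unchanged by moving along it: `SL · (g · f) = SL · f`. [folklore] -/
private theorem slOrbit_linSubst_sl (g : Matrix.SpecialLinearGroup σ ℂ) (f : MvPolynomial σ ℂ) :
    slOrbit σ ℂ (linSubst σ ℂ (g : Matrix σ σ ℂ) f) = slOrbit σ ℂ f := by
  ext h
  rw [mem_slOrbit_iff, mem_slOrbit_iff]
  constructor
  · rintro ⟨g', rfl⟩
    refine ⟨g' * g, ?_⟩
    rw [Matrix.SpecialLinearGroup.coe_mul, linSubst_mul, AlgHom.comp_apply]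
  · rintro ⟨g', rfl⟩
    refine ⟨g' * g⁻¹, ?_⟩
    rw [← AlgHom.comp_apply, ← linSubst_mul, ← Matrix.SpecialLinearGroup.coe_mul, mul_assoc,
      inv_mul_cancel, mul_one]

/-- Rigid support ⇒ the off-diagonal moment entries vanish. [folklore] -/
private theorem momentMatrix_apply_eq_zero_of_rigid' {n : ℕ} (S : (Fin n → σ) → ℂ)
    (hrigid : ∀ (j : Fin n → σ) (k : Fin n) (b : σ),
      S j ≠ 0 → S (Function.update j k b) ≠ 0 → b = j k)
    {a b : σ} (hab : a ≠ b) : momentMatrix S a b = 0 := by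
  rw [momentMatrix_apply]
  refine Finset.sum_eq_zero fun k _ => Finset.sum_eq_zero fun j _ => ?_
  by_cases hjk : j k = a
  · rw [if_pos hjk]
    by_cases hS : S j = 0
    · rw [hS, mul_zero]
    by_cases hS' : S (Function.update j k b) = 0
    · rw [hS', map_zero, zero_mul]
    exact absurd (hjk.symm.trans (hrigid j k b hS hS').symm) hab
  · rw [if_neg hjk]

/-- The diagonal moment entries as content-weighted sums: `M_{aa} = ∑_j content(j)_a |S j|²`.
[folklore] -/
private theorem momentMatrix_apply_self_eq_sum_tcontent {n : ℕ} (S : (Fin n → σ) → ℂ) (a : σ) :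
    momentMatrix S a a = ((∑ j : Fin n → σ, (tcontent j a : ℝ) * ‖S j‖ ^ 2 : ℝ) : ℂ) := by
  rw [momentMatrix_apply_self_eq_ofReal]
  congr 1
  rw [Finset.sum_comm]
  refine Finset.sum_congr rfl fun j _ => ?_
  rw [← sum_ite_eq_tcontent, Finset.sum_mul]
  refine Finset.sum_congr rfl fun k _ => ?_
  split_ifs <;> simp

end Orbit

/-! ### The corrected criterion -/

section Main

open MS2001Thm73

variable {σ : Type*} [Fintype σ] [DecidableEq σ]

/-- **The criterion behind BI 2017 Prop. 2.8 (corrected), rigid-support form, any finite index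
type.** Let `f` be a form of degree `D` whose support is RIGID (no two exponents of `supp(f)` differ
by moving one unit of degree between two variables — the consequence of hypothesis 1 of Prop. 2.8,
`support_rigid_of_diagonalStabilizer` / `support_rigid_of_separating`) and suppose there are
rational `c_α > 0`, `α ∈ supp(f)`, with `∑_α c_α α_i = 1` for every `i`. Then the `SL(σ)`-orbit of
`f` is Zariski closed (`f` is polystable). [cite: BurgisserIkenmeyer2017, Prop. 2.8 (corrected; see module doc)] -/
theorem isPolystable_of_rigid_of_posCone {D : ℕ} (f : MvPolynomial σ ℂ)
    (hf : f.IsHomogeneous D)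
    (hrig : ∀ (j : Fin D → σ) (k : Fin D) (b : σ), coeff (tcontent j) f ≠ 0 →
      coeff (tcontent (Function.update j k b)) f ≠ 0 → b = j k)
    (c : (σ →₀ ℕ) → ℚ) (hcpos : ∀ α ∈ f.support, 0 < c α)
    (hc : ∀ i : σ, ∑ α ∈ f.support, c α * (α i : ℚ) = 1) : IsPolystable f := by
  classical
  set S₀ : (Fin D → σ) → ℂ := symTensor D f with hS₀def
  have hsymm : ∀ (π : Equiv.Perm (Fin D)) (j : Fin D → σ), S₀ (j ∘ π) = S₀ j :=
    fun π j => symTensor_comp_perm f π j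
  have hpoly : tensorToPoly S₀ = f := tensorToPoly_symTensor hf
  -- support of `S₀`
  have hsupp : ∀ j : Fin D → σ, S₀ j ≠ 0 ↔ coeff (tcontent j) f ≠ 0 := by
    intro j
    have hN : (contentClassCard j : ℂ) ≠ 0 := by
      have : 0 < contentClassCard j := Fintype.card_pos_iff.mpr ⟨⟨j, rfl⟩⟩
      exact_mod_cast this.ne'
    rw [hS₀def]
    unfold symTensor
    rw [Ne, div_eq_zero_iff, not_or]
    exact ⟨fun h => h.1, fun h => ⟨h, hN⟩⟩
  have hrig₀ : ∀ (j : Fin D → σ) (k : Fin D) (b : σ),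
      S₀ j ≠ 0 → S₀ (Function.update j k b) ≠ 0 → b = j k :=
    fun j k b h1 h2 => hrig j k b ((hsupp _).mp h1) ((hsupp _).mp h2)
  -- degenerate cases: empty alphabet, or `f = 0`
  rcases isEmpty_or_nonempty σ with hσ | hσ
  · have hmm : momentMatrix S₀ = (0 : ℂ) • (1 : Matrix σ σ ℂ) := Subsingleton.elim _ _
    have := isPolystable_tensorToPoly_of_momentMatrix_eq_smul_one hsymm hmm
    rwa [hpoly] at this
  by_cases hS0 : S₀ = 0
  · have hmm : momentMatrix S₀ = (0 : ℂ) • (1 : Matrix σ σ ℂ) := by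
      ext a b
      rw [momentMatrix_apply, zero_smul, Matrix.zero_apply]
      exact Finset.sum_eq_zero fun k _ => Finset.sum_eq_zero fun j _ => by simp [hS0]
    have := isPolystable_tensorToPoly_of_momentMatrix_eq_smul_one hsymm hmm
    rwa [hpoly] at this
  obtain ⟨j₀, hj₀⟩ : ∃ j, S₀ j ≠ 0 := by
    by_contra h
    push Not at h
    exact hS0 (funext h)
  -- every exponent of `f` is a content (so the fibres of `content` over `supp f` are nonempty)
  have hfib : ∀ α ∈ f.support, ∃ j : Fin D → σ, tcontent j = α := by
    intro α hα
    by_contra hno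
    push Not at hno
    have h0 : coeff α f = 0 := by
      rw [← hpoly, coeff_tensorToPoly]
      exact Finset.sum_eq_zero fun j hj => absurd (Finset.mem_filter.mp hj).2 (hno j)
    exact (MvPolynomial.mem_support_iff.mp hα) h0
  have hsupp' : ∀ j : Fin D → σ, S₀ j ≠ 0 ↔ tcontent j ∈ f.support := by
    intro j; rw [hsupp, MvPolynomial.mem_support_iff]
  -- real data: total weight, fibre sizes
  set Ctot : ℝ := ∑ α ∈ f.support, (c α : ℝ) with hCtot
  have hCtot_pos : 0 < Ctot := by
    have hmem : tcontent j₀ ∈ f.support := (hsupp' j₀).mp hj₀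
    have h1 : (c (tcontent j₀) : ℝ) ≤ Ctot :=
      Finset.single_le_sum (f := fun α => (c α : ℝ))
        (fun α hα => by exact_mod_cast (hcpos α hα).le) hmem
    have h2 : (0 : ℝ) < c (tcontent j₀) := by exact_mod_cast hcpos _ hmem
    linarith
  set N : (σ →₀ ℕ) → ℕ := fun α =>
    (Finset.univ.filter fun j' : Fin D → σ => tcontent j' = α).card with hN
  have hNpos : ∀ j : Fin D → σ, 0 < N (tcontent j) := fun j =>
    Finset.card_pos.mpr ⟨j, by simp⟩
  -- sums over the support words versus sums over all words
  have hconv : ∀ F : (Fin D → σ) → ℝ, (∀ j, S₀ j = 0 → F j = 0) →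
      ∑ p : {j : Fin D → σ // S₀ j ≠ 0}, F p.1 = ∑ j, F j := by
    intro F hF
    calc ∑ p : {j : Fin D → σ // S₀ j ≠ 0}, F p.1
        = ∑ j ∈ Finset.univ.filter (fun j : Fin D → σ => S₀ j ≠ 0), F j :=
          (Finset.sum_subtype _ (fun p => by simp) F).symm
      _ = ∑ j, F j := Finset.sum_filter_of_ne fun j _ hFj hSj => hFj (hF j hSj)
  haveI : Nonempty {j : Fin D → σ // S₀ j ≠ 0} := ⟨⟨j₀, hj₀⟩⟩
  -- Step 2: the minimisation
  set q : {j : Fin D → σ // S₀ j ≠ 0} → ℝ := fun p => ‖S₀ p.1‖ ^ 2 with hq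
  have hqpos : ∀ p, 0 < q p := fun p => pow_pos (norm_pos_iff.mpr p.2) 2
  set a : {j : Fin D → σ // S₀ j ≠ 0} → ℝ :=
    fun p => (c (tcontent p.1) : ℝ) / ((N (tcontent p.1) : ℝ) * Ctot) with ha
  have hapos : ∀ p, 0 < a p := by
    intro p
    have h1 : (0 : ℝ) < c (tcontent p.1) := by exact_mod_cast hcpos _ ((hsupp' _).mp p.2)
    have h2 : (0 : ℝ) < N (tcontent p.1) := by exact_mod_cast hNpos p.1
    exact div_pos h1 (mul_pos h2 hCtot_pos)
  -- `F j = 0` off the support, for the `ite`s fed to `sum_fiber_content`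
  have hoff : ∀ (φ : (σ →₀ ℕ) → ℝ) (j : Fin D → σ), S₀ j = 0 →
      (if tcontent j ∈ f.support then φ (tcontent j) / (N (tcontent j) : ℝ) else 0) = 0 := by
    intro φ j hj
    rw [if_neg (fun h => (hsupp' j).mpr h hj)]
  have hasum : ∑ p, a p = 1 := by
    have h1 : ∑ p : {j : Fin D → σ // S₀ j ≠ 0}, a p =
        ∑ j : Fin D → σ, (if tcontent j ∈ f.support then
          (fun α : σ →₀ ℕ => (c α : ℝ) / Ctot) (tcontent j) / (N (tcontent j) : ℝ) else 0) := by
      rw [← hconv _ (hoff (fun α : σ →₀ ℕ => (c α : ℝ) / Ctot))]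
      refine Finset.sum_congr rfl fun p _ => ?_
      rw [if_pos ((hsupp' _).mp p.2)]
      simp only [ha]
      ring
    rw [h1]
    simp only [hN]
    rw [sum_fiber_content f.support hfib (fun α : σ →₀ ℕ => (c α : ℝ) / Ctot), ← Finset.sum_div,
      hCtot]
    exact div_self hCtot_pos.ne'
  obtain ⟨U, hU⟩ := exists_tracelessSubmodule_words (σ := σ) {j : Fin D → σ // S₀ j ≠ 0}
    (fun p => p.1)
  have hUa : ∀ u ∈ U, ∑ p, a p * u p = 0 := by
    intro u hu
    obtain ⟨x, hx, rfl⟩ := (hU u).mp hu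
    have h1 : ∑ p : {j : Fin D → σ // S₀ j ≠ 0}, a p * ∑ k, x (p.1 k) =
        ∑ j : Fin D → σ, (if tcontent j ∈ f.support then
          (fun α : σ →₀ ℕ => (c α : ℝ) * (∑ i, (α i : ℝ) * x i) / Ctot) (tcontent j) /
            (N (tcontent j) : ℝ) else 0) := by
      rw [← hconv _ (hoff (fun α : σ →₀ ℕ => (c α : ℝ) * (∑ i, (α i : ℝ) * x i) / Ctot))]
      refine Finset.sum_congr rfl fun p _ => ?_
      rw [if_pos ((hsupp' _).mp p.2), sum_comp_eq_sum_tcontent_mul]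
      simp only [ha]
      ring
    rw [h1]
    simp only [hN]
    rw [sum_fiber_content f.support hfib
      (fun α : σ →₀ ℕ => (c α : ℝ) * (∑ i, (α i : ℝ) * x i) / Ctot), ← Finset.sum_div]
    -- `∑_α c_α ∑_i α_i x_i = ∑_i x_i (∑_α c_α α_i) = ∑_i x_i = 0`
    have h2 : ∑ α ∈ f.support, (c α : ℝ) * ∑ i, (α i : ℝ) * x i = ∑ i, x i := by
      rw [show (∑ α ∈ f.support, (c α : ℝ) * ∑ i, (α i : ℝ) * x i) =
          ∑ i, (∑ α ∈ f.support, (c α : ℝ) * (α i : ℝ)) * x i from by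
        simp_rw [Finset.mul_sum, Finset.sum_mul]
        rw [Finset.sum_comm]
        exact Finset.sum_congr rfl fun i _ => Finset.sum_congr rfl fun α _ => by ring]
      refine Finset.sum_congr rfl fun i _ => ?_
      have := congrArg (fun r : ℚ => (r : ℝ)) (hc i)
      push_cast at this
      rw [this, one_mul]
    rw [h2, hx, zero_div]
  obtain ⟨u₀, hu₀U, hmin⟩ := exists_isMinOn_sum_mul_exp q a hqpos hapos hasum U hUa
  obtain ⟨x, hx, hu₀⟩ := (hU u₀).mp hu₀U
  -- the rescaled squared weights
  set Q : (Fin D → σ) → ℝ := fun j => ‖S₀ j‖ ^ 2 * Real.exp (∑ k, x (j k)) with hQ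
  have hQ0 : ∀ j, S₀ j = 0 → Q j = 0 := by intro j hj; simp [hQ, hj]
  have hcq : ∀ p : {j : Fin D → σ // S₀ j ≠ 0}, q p * Real.exp (u₀ p) = Q p.1 := by
    intro p; rw [hu₀]
  -- first-order conditions
  have hfo : ∀ d : {j : Fin D → σ // S₀ j ≠ 0} → ℝ, (∀ s : ℝ, u₀ + s • d ∈ U) →
      ∑ p, Q p.1 * d p = 0 := by
    intro d hd
    have h := sum_mul_eq_zero_of_forall_le_sum_mul_exp (fun p => q p * Real.exp (u₀ p)) d
      fun s => by
        have := hmin _ (hd s)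
        simpa only [Pi.add_apply, Pi.smul_apply, smul_eq_mul, Real.exp_add, ← mul_assoc,
          mul_comm s] using this
    simpa only [hcq] using h
  set G : σ → ℝ := fun a => ∑ j : Fin D → σ, (tcontent j a : ℝ) * Q j with hG
  have hGeq : ∀ a b : σ, G a = G b := by
    intro a b
    have h := hfo (fun p => (tcontent p.1 a : ℝ) - (tcontent p.1 b : ℝ)) fun s => by
      rw [hU]
      refine ⟨x + s • fun t => (if t = a then 1 else 0) - (if t = b then 1 else 0), ?_, ?_⟩
      · simp only [Pi.add_apply, Pi.smul_apply, smul_eq_mul, Finset.sum_add_distrib, hx, zero_add,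
          ← Finset.mul_sum, Finset.sum_sub_distrib, Finset.sum_ite_eq', Finset.mem_univ, if_true,
          sub_self, mul_zero]
      · funext p
        simp only [hu₀, Pi.add_apply, Pi.smul_apply, smul_eq_mul, Finset.sum_add_distrib,
          ← Finset.mul_sum, Finset.sum_sub_distrib, sum_ite_eq_tcontent]
    rw [hconv (fun j => Q j * ((tcontent j a : ℝ) - (tcontent j b : ℝ)))
      (fun j hj => by rw [hQ0 j hj, zero_mul])] at h
    simp only [mul_sub, Finset.sum_sub_distrib] at h
    have e : ∀ z : σ, ∑ j : Fin D → σ, Q j * (tcontent j z : ℝ) = G z := fun z =>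
      Finset.sum_congr rfl fun j _ => mul_comm _ _
    rw [e, e] at h
    linarith
  -- Step 3: the rescaled tensor `S'`
  set e : σ → ℂ := fun i => ((Real.exp (x i / 2) : ℝ) : ℂ) with he
  set S' : (Fin D → σ) → ℂ := tensorAct (Matrix.diagonal e) S₀ with hS'
  have hS'apply : ∀ j, S' j = ((Real.exp ((∑ k, x (j k)) / 2) : ℝ) : ℂ) * S₀ j := by
    intro j
    rw [hS', tensorAct_diagonal]
    simp only [he]
    rw [← Complex.ofReal_prod, ← Real.exp_sum, ← Finset.sum_div]
  have hS'zero : ∀ j, S' j = 0 ↔ S₀ j = 0 := by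
    intro j
    rw [hS'apply, mul_eq_zero]
    have : ((Real.exp ((∑ k, x (j k)) / 2) : ℝ) : ℂ) ≠ 0 := by
      exact_mod_cast (Real.exp_pos _).ne'
    exact ⟨fun h => h.resolve_left this, fun h => Or.inr h⟩
  have hnormS' : ∀ j, ‖S' j‖ ^ 2 = Q j := by
    intro j
    rw [hS'apply, norm_mul, Complex.norm_real, Real.norm_eq_abs, abs_of_pos (Real.exp_pos _),
      mul_pow, hQ]
    simp only
    rw [sq (Real.exp _), ← Real.exp_add, add_halves, mul_comm]
  have hsymm' : ∀ (π : Equiv.Perm (Fin D)) (j : Fin D → σ), S' (j ∘ π) = S' j :=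
    fun π j => tensorAct_symm hsymm _ π j
  have hrig' : ∀ (j : Fin D → σ) (k : Fin D) (b : σ),
      S' j ≠ 0 → S' (Function.update j k b) ≠ 0 → b = j k := by
    intro j k b h1 h2
    exact hrig₀ j k b (fun h => h1 ((hS'zero j).mpr h)) (fun h => h2 ((hS'zero _).mpr h))
  obtain ⟨a₀⟩ := hσ
  have hmm : momentMatrix S' = ((G a₀ : ℝ) : ℂ) • (1 : Matrix σ σ ℂ) := by
    ext a b
    rw [Matrix.smul_apply, smul_eq_mul]
    by_cases hab : a = b
    · subst hab
      rw [Matrix.one_apply_eq, mul_one, momentMatrix_apply_self_eq_sum_tcontent, hGeq a₀ a]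
      congr 1
      exact Finset.sum_congr rfl fun j _ => by rw [hnormS']
    · rw [Matrix.one_apply_ne hab, mul_zero]
      exact momentMatrix_apply_eq_zero_of_rigid' S' hrig' hab
  have hps : IsPolystable (tensorToPoly S') :=
    isPolystable_tensorToPoly_of_momentMatrix_eq_smul_one hsymm' hmm
  -- transport back along the orbit
  have hdet : (Matrix.diagonal e).det = 1 := by
    rw [Matrix.det_diagonal]
    simp only [he]
    rw [← Complex.ofReal_prod, ← Real.exp_sum, ← Finset.sum_div, hx]
    simp
  have htp : tensorToPoly S' = linSubst σ ℂ (Matrix.diagonal e) f := by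
    rw [hS', tensorToPoly_tensorAct, hpoly]
  rw [htp] at hps
  have horb := slOrbit_linSubst_sl (⟨Matrix.diagonal e, hdet⟩ : Matrix.SpecialLinearGroup σ ℂ) f
  unfold IsPolystable at hps ⊢
  change zariskiClosure (coeffVec '' slOrbit σ ℂ (linSubst σ ℂ (Matrix.diagonal e) f)) ⊆
    coeffVec '' slOrbit σ ℂ (linSubst σ ℂ (Matrix.diagonal e) f) at hps
  rw [show (Matrix.diagonal e) = ((⟨Matrix.diagonal e, hdet⟩ : Matrix.SpecialLinearGroup σ ℂ) :
    Matrix σ σ ℂ) from rfl, horb] at hps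
  exact hps

/-- **BI 2017, Prop. 2.8 (corrected: `(1,…,1)` in the relative interior of the cone of `supp(f)`),
diagonal `R`, any finite index type.** Let `f` be a form of degree `D`. Suppose (1) `R ≤ SL(σ)`
consists of diagonal matrices fixing `f` and every element of `SL(σ)` commuting with `R` is
diagonal; (2) there are rational `c_α > 0`, `α ∈ supp(f)`, with `∑_α c_α α_i = 1` for every `i`.
Then the `SL(σ)`-orbit of `f` is Zariski closed (`f` is polystable).
[cite: BurgisserIkenmeyer2017, Prop. 2.8 (corrected; see module doc)] -/
theorem isPolystable_of_diagonalStabilizer_of_posCone {D : ℕ} (f : MvPolynomial σ ℂ)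
    (hf : f.IsHomogeneous D) (R : Subgroup (Matrix.SpecialLinearGroup σ ℂ))
    (hR : ∀ r ∈ R, (r : Matrix σ σ ℂ).IsDiag ∧ linSubst σ ℂ (r : Matrix σ σ ℂ) f = f)
    (hcent : ∀ g : Matrix.SpecialLinearGroup σ ℂ, (∀ r ∈ R, g * r = r * g) →
      (g : Matrix σ σ ℂ).IsDiag)
    (c : (σ →₀ ℕ) → ℚ) (hcpos : ∀ α ∈ f.support, 0 < c α)
    (hc : ∀ i : σ, ∑ α ∈ f.support, c α * (α i : ℚ) = 1) : IsPolystable f :=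
  isPolystable_of_rigid_of_posCone f hf
    (fun j k b h1 h2 => support_rigid_of_diagonalStabilizer f R hR hcent j k b h1 h2) c hcpos hc

/-- **The criterion in consumable form: separating diagonal stabilizers.** Let `f` be a form of
degree `D` such that (1') for all `a ≠ b` some diagonal substitution `diag(d)` FIXING `f` has
`d_a ≠ d_b` (this is what hypothesis 1 of Prop. 2.8 is used for, cf. the proof of Cor. 2.9), and
(2) there are rational `c_α > 0`, `α ∈ supp(f)`, with `∑_α c_α α_i = 1` for every `i`. Then `f` is
polystable. No subgroup or centralizer bookkeeping is needed to apply it.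
[cite: BurgisserIkenmeyer2017, Prop. 2.8 (corrected) and Cor. 2.9 (proof)] -/
theorem isPolystable_of_separating_diagonalStabilizers {D : ℕ} (f : MvPolynomial σ ℂ)
    (hf : f.IsHomogeneous D)
    (hsep : ∀ a b : σ, a ≠ b → ∃ d : σ → ℂ, linSubst σ ℂ (Matrix.diagonal d) f = f ∧ d a ≠ d b)
    (c : (σ →₀ ℕ) → ℚ) (hcpos : ∀ α ∈ f.support, 0 < c α)
    (hc : ∀ i : σ, ∑ α ∈ f.support, c α * (α i : ℚ) = 1) : IsPolystable f :=
  isPolystable_of_rigid_of_posCone f hf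
    (fun j k b h1 h2 => support_rigid_of_separating f hsep j k b h1 h2) c hcpos hc

/-- **BI 2017, Prop. 2.8 AS CORRECTED** (diagonal `R`; `Fin m`; the shape of the tree's
`BI2017_prop_2_8_diag` with the single extra hypothesis that `c` is POSITIVE on `supp(f)`, i.e.
`(1,…,1)` lies in the relative interior of the cone generated by `supp(f)`): then `f` is
polystable. The statement without the positivity clause is false (`not_BI2017_prop_2_8_diag`).
[cite: BurgisserIkenmeyer2017, Prop. 2.8 (corrected; see module doc)] -/
theorem BI2017_prop_2_8_diag_corrected :
    ∀ (m D : ℕ) (f : MvPolynomial (Fin m) ℂ), f.IsHomogeneous D →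
      ∀ R : Subgroup (Matrix.SpecialLinearGroup (Fin m) ℂ),
        (∀ r ∈ R, (r : Matrix (Fin m) (Fin m) ℂ).IsDiag ∧
          linSubst (Fin m) ℂ (r : Matrix (Fin m) (Fin m) ℂ) f = f) →
        (∀ g : Matrix.SpecialLinearGroup (Fin m) ℂ, (∀ r ∈ R, g * r = r * g) →
          (g : Matrix (Fin m) (Fin m) ℂ).IsDiag) →
        (∃ c : (Fin m →₀ ℕ) → ℚ, (∀ α, 0 ≤ c α) ∧ (∀ α ∈ f.support, 0 < c α) ∧
          ∀ i : Fin m, ∑ α ∈ f.support, c α * (α i : ℚ) = 1) →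
        IsPolystable f := by
  intro m D f hf R hR hcent hc
  obtain ⟨c, -, hcpos, hc⟩ := hc
  exact isPolystable_of_diagonalStabilizer_of_posCone f hf R hR hcent c hcpos hc

/-- **Application (any finite set of variables): the powers `(∏_i X_i)^a` (`a ≥ 1`) of the product
of ALL variables are polystable** — generalising the `X₁⋯X_m` clause of BI 2017 Cor. 2.9: the
support is the single exponent `(a,…,a)`, so `c = 1/a` works, and `diag(2, 1/2, 1, …, 1)`-type
substitutions (`d^{(a,…,a)} = (∏ d)^a = 1`) fix the form and separate any two variables.
[cite: BurgisserIkenmeyer2017, Cor. 2.9 (the `X₁⋯X_m` clause, generalised to powers)] -/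
theorem isPolystable_univ_prod_X_pow (a : ℕ) (ha : 0 < a) :
    IsPolystable ((∏ i : σ, X i) ^ a : MvPolynomial σ ℂ) := by
  classical
  set α₀ : σ →₀ ℕ := a • ∑ i : σ, Finsupp.single i 1 with hα₀
  have hf : ((∏ i : σ, X i) ^ a : MvPolynomial σ ℂ) = monomial α₀ 1 := by
    rw [show (∏ i : σ, X i : MvPolynomial σ ℂ) = monomial (∑ i : σ, Finsupp.single i 1) 1
      from by rw [monomial_sum_one]; rfl, monomial_pow, one_pow]
  have hα₀i : ∀ i, α₀ i = a := by
    intro i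
    simp only [hα₀, Finsupp.coe_smul, Pi.smul_apply, smul_eq_mul, Finsupp.coe_finsetSum,
      Finset.sum_apply, Finsupp.single_apply, Finset.sum_ite_eq', Finset.mem_univ, if_true, mul_one]
  have hhom : ((∏ i : σ, X i) ^ a : MvPolynomial σ ℂ).IsHomogeneous (Fintype.card σ * a) := by
    rw [hf]
    refine isHomogeneous_monomial _ ?_
    rw [Finsupp.degree_eq_sum]
    simp [hα₀i]
  have hsupp : ((∏ i : σ, X i) ^ a : MvPolynomial σ ℂ).support = {α₀} := by
    rw [hf, support_monomial, if_neg one_ne_zero]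
  refine isPolystable_of_separating_diagonalStabilizers _ hhom ?_ (fun _ => 1 / a) ?_ ?_
  · intro p q hpq
    refine ⟨Function.update (Function.update (fun _ => (1 : ℂ)) p 2) q (1 / 2), ?_, ?_⟩
    · rw [hf, linSubst_diagonal_monomial]
      have hprod : (α₀.prod fun i n =>
          Function.update (Function.update (fun _ => (1 : ℂ)) p 2) q (1 / 2) i ^ n) = 1 := by
        rw [Finsupp.prod_fintype _ _ (fun i => pow_zero _)]
        simp_rw [hα₀i]
        rw [Finset.prod_pow, ← Finset.prod_erase_mul _ _ (Finset.mem_univ q),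
          Function.update_self, ← Finset.prod_erase_mul _ _
            (Finset.mem_erase.mpr ⟨hpq, Finset.mem_univ p⟩), Function.update_of_ne hpq,
          Function.update_self, Finset.prod_eq_one fun i hi => ?_]
        · norm_num
        · rw [Function.update_of_ne (Finset.ne_of_mem_erase (Finset.mem_of_mem_erase hi)),
            Function.update_of_ne (Finset.ne_of_mem_erase hi)]
      rw [hprod, one_smul]
    · rw [Function.update_of_ne hpq, Function.update_self, Function.update_self]
      norm_num
  · intro α _
    have : (0 : ℚ) < a := by exact_mod_cast ha
    positivity
  · intro i
    rw [hsupp, Finset.sum_singleton, hα₀i]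
    have : (a : ℚ) ≠ 0 := by exact_mod_cast ha.ne'
    field_simp

/-- **Application: the powers of the Chow form, `(X₁⋯X_m)^a` (`a ≥ 1`), are polystable** —
generalising the `X₁⋯X_m` clause of BI 2017 Cor. 2.9 (`isPolystable_prod_X`); the `Fin m` instance
of `isPolystable_univ_prod_X_pow`.
[cite: BurgisserIkenmeyer2017, Cor. 2.9 (the `X₁⋯X_m` clause, generalised to powers)] -/
theorem isPolystable_prod_X_pow (m a : ℕ) (ha : 0 < a) :
    IsPolystable ((∏ i : Fin m, X i) ^ a : MvPolynomial (Fin m) ℂ) :=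
  isPolystable_univ_prod_X_pow a ha

end Main

end Literature.Computability.AlgebraicComplexity
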